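/-
Copyright (c) 2026 the pub-hodgecm-mathlib formalisation cell (harness21).  Prover seat hodgecm-mathlib-LH4-p01 (g10): road M6 → F3 «TOT-Λ BY OVER-ORDERS» (LEAD F0P3a-plan
T14-66), F3-5 pen LH7-p04 (g12) DEAL D′ 01:23:47Z «THE TYPE-(2) ORDER OF A ⋆-STABLE PAIR», FILE D′γ ((D′2)); 2026-09-03.
-/
import Literature.NumberTheory.Automorphic.TypeTwoPairOfEisensteinData        -- ★ (c5-ii) FILE D p853172 (this seat): `mul_eq_neg_one_and_eq_of_rel`, `trace_fin_two_mem_integer`, `det_fin_two_mem_integer`; brings ★ (ζ1), ★ (c5-i) `det_smul_one_sub_eq`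
import Literature.NumberTheory.Automorphic.GluedOverOrderOfStarStablePair     -- ★ D′α (this seat): `exists_coe_range_eval₂_eq_glued_map_of_star_mem`
import Literature.NumberTheory.Automorphic.StarPolynomialOfPair              -- ★ D′β (this seat): `exists_map_integer_subtype_eq_of_coeff_mem`; brings ★ (D3) `prodMap_subtype_eval₂_eq`
import HarnessLib

/-!
# The type-(2) pair of the Eisenstein data, ⋆-POLYNOMIAL form: ★ FILE D with unitarity replaced by «`x⋆ = P(x)`, `P ∈ 𝒪_E[X]`» — the shift-stable side condition of F3-5
# (Rogawski 1990 §4.9; Neukirch I §12; Serre I §6)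

Topic `NumberTheory/Automorphic`; namespace `Literature.NumberTheory.Automorphic`.  THEOREMS ONLY (no definition, no instance, no notation, no named fact, no `sorry`); kernel lane
`--supports stmt-HodgeConjecture-24833`.  Cell `pub/hodgecm-mathlib` (D-0151), crux H413 = `stmt-HodgeConjecture-24833`; road M6 → F3 «TOT-Λ by over-orders» (route (B)); F3-5 pen
LH7-p04 (g12) DEAL D′ (D′2).  ★ (W1) `ncard_vertex_rowZero_eq_of_total` evaluates the TOT-Λ binder at shifted, non-unitary pairs, so F3-5b-III's side condition `C g u` cannot
carry `u·σu = 1 ∧ λ·σ_Kλ = 1`; it carries «`(σu, σ_Kλ) = P(u, λ)` for some `P ∈ E[X]` with coefficients in `𝒪_E`» instead (★ D′β `StarPolynomialOfPair`: true for unitary pairs,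
stable under the shift).  This file is ★ FILE D `TypeTwoPairOfEisensteinData` re-cut on that binder: same outputs (`uO pO qO tO DO`, `hlam2 hN hn`, the glued order
`G(N′, n′, ιO y)` and its monogenic level), with `hxstar` replaced by `hstarmem : x⋆ ∈ 𝒪_E[x]` (★ D′α `GluedOverOrderOfStarStablePair`); the ⋆-membership is `P₀(x)` for
the lift `P₀ ∈ 𝒪_E[X]` of `P` (★ D′β `exists_map_integer_subtype_eq_of_coeff_mem`, ★ (D3) `prodMap_subtype_eval₂_eq`).
HONEST LABEL: HC_CM is proved only modulo the 7 printed citations (2 remaining named inputs: hLiu418 = stmt-HodgeConjecture-24832, h413 = stmt-HodgeConjecture-24833) until rung 0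
closes; valued linear algebra, count-neutral (pays no organ, opens no road; zero label movement until F5 ★ + a desk-priced rider).
[cite: Rogawski1990, §4.9 Lemma 4.9.3 p. 56, Prop. 4.9.1 (b) p. 55] [cite: Neukirch1999, Ch. I §12; Ch. II §4–§5] [cite: SerreLocalFields1979, Ch. I §6 Prop. 17–18]

* §2 **`exists_integralPair_of_eisensteinData_of_starPoly`**; §3 **`exists_typeTwoOrder_of_eisensteinData_of_starPoly`**.

## References
* [Rogawski1990] J. D. Rogawski, *Automorphic Representations of Unitary Groups in Three Variables*, Ann. of Math. Stud. 123 (1990): §4.9 Lemma 4.9.3 p. 56, Prop. 4.9.1 (b) p. 55.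
* [Neukirch1999] J. Neukirch, *Algebraic Number Theory*, Grundlehren 322 (1999): Ch. I §12; Ch. II §4–§5.
* [SerreLocalFields1979] J.-P. Serre, *Local Fields*, GTM 67 (1979): Ch. I §6 Prop. 17–18.
-/

set_option autoImplicit false

noncomputable section

open scoped ValuativeRel
open ValuativeRel Matrix Polynomial

namespace Literature.NumberTheory.Automorphic

/-! ## §2 The integral pair `(u, λ = jO p + jO q θ)` with ★ (c6)'s binders -/

section Pair

variable {E : Type*} [Field E] [ValuativeRel E] {K : Type*} [Field K] [ValuativeRel K] [Algebra E K]
  (hval : ∀ x : E, valuation K (algebraMap E K x) ≤ 1 ↔ valuation E x ≤ 1)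
  (jO : 𝒪[E] →+* 𝒪[K]) (hjO : ∀ x : 𝒪[E], ((jO x : 𝒪[K]) : K) = algebraMap E K x)
  (θ : 𝒪[K]) {aE kE : 𝒪[E]} (hθ : θ ^ 2 = jO aE * θ + jO kE) (ha : aE ∈ IsLocalRing.maximalIdeal 𝒪[E])
  {ϖ : E} (hϖ : IsUniformizingElement ϖ) (hk₁ : valuation E (kE : E) = valuation E ϖ)
  (hcoord : ∀ z : 𝒪[K], ∃! bc : 𝒪[E] × 𝒪[E], z = jO bc.1 + jO bc.2 * θ)
  (σ : E →+* E) (σK : K →+* K) (σO : 𝒪[E] →+* 𝒪[E]) (hσO : ∀ x : 𝒪[E], ((σO x : 𝒪[E]) : E) = σ x)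
  (σKO : 𝒪[K] →+* 𝒪[K]) (hσKO : ∀ z : 𝒪[K], ((σKO z : 𝒪[K]) : K) = σK z)

include hval hjO hθ ha hϖ hk₁ hcoord hσO hσKO in
/-- **(D′2) THE TYPE-(2) PAIR OF THE EISENSTEIN DATA, ⋆-POLYNOMIAL FORM** (★ FILE D `exists_integralPair_of_eisensteinData` with the unitarity `u·σu = 1`, `λ·σ_Kλ = 1` REPLACED by «`(σu, σ_Kλ) = P(u, λ)`, `P ∈ E[X]` with coefficients in `𝒪_E`» and the output unitarity by `hstarmem : x⋆ ∈ 𝒪_E[x]`, ★ D′α's binder).  In ★ (ζ1)'s valued frame, from ★ (W1)'s `hT` data (`g` integral, non-scalar via `g₁₀ ≠ 0`; `u` integral; `Θ = α•1 + β•g`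
with `|det Θ| = |ϖ|`, `|tr Θ| < 1`; `u•1 − g = a•1 + b•Θ`; `|det(u•1 − g)| = |ϖ|^n`; `|b| = |ϖ|^N`) and a root `λ ∈ K` of `χ_g` with `u·σu = 1`, `λ·σ_Kλ = 1`: there are integral
`uO pO qO tO DO` over `u`, ·, ·, `tr g`, `det g` with `λ = jO pO + jO qO·θ` and ★ D′α `exists_coe_range_eval₂_eq_glued_map_of_star_mem`'s four binders `hlam2 hstarmem hN hn` VERBATIM.
[cite: Rogawski1990, §4.9 Lemma 4.9.3 p. 56] [cite: Neukirch1999, Ch. I §12] [cite: SerreLocalFields1979, Ch. I §6 Prop. 17–18] -/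
theorem exists_integralPair_of_eisensteinData_of_starPoly
    {g Θ : Matrix (Fin 2) (Fin 2) E} {u α β a b : E} {n N : ℕ}
    (hg : ∀ i j, g i j ∈ 𝒪[E]) (hu : u ∈ 𝒪[E]) (h10 : g 1 0 ≠ 0)
    (hΘ : Θ = α • 1 + β • g) (hΘd : valuation E Θ.det = valuation E ϖ) (hΘt : valuation E Θ.trace < 1)
    (hrel : u • (1 : Matrix (Fin 2) (Fin 2) E) - g = a • 1 + b • Θ)
    (hn : valuation E (u • (1 : Matrix (Fin 2) (Fin 2) E) - g).det = valuation E ϖ ^ n) (hb : valuation E b = valuation E ϖ ^ N)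
    {lam : K} (hlam : lam ^ 2 - algebraMap E K g.trace * lam + algebraMap E K g.det = 0)
    (P : E[X]) (hP : ∀ i, P.coeff i ∈ 𝒪[E]) (hPx : aeval ((u, lam) : E × K) P = (σ u, σK lam)) :
    ∃ uO pO qO tO DO : 𝒪[E], (uO : E) = u ∧ (tO : E) = g.trace ∧ (DO : E) = g.det ∧ ((jO pO + jO qO * θ : 𝒪[K]) : K) = lam ∧
      (jO pO + jO qO * θ) ^ 2 - jO tO * (jO pO + jO qO * θ) + jO DO = 0 ∧
      RingHom.prodMap σO σKO ((uO, jO pO + jO qO * θ) : 𝒪[E] × 𝒪[K]) ∈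
        (Polynomial.eval₂RingHom (RingHom.prod (RingHom.id 𝒪[E]) jO) ((uO, jO pO + jO qO * θ) : 𝒪[E] × 𝒪[K])).range ∧
      valuation E ((qO : 𝒪[E]) : E) = valuation E ϖ ^ N ∧
      valuation E ((uO * uO - tO * uO + DO : 𝒪[E]) : E) = valuation E ϖ ^ n := by
  subst hΘ
  -- ### 1. the matrix bookkeeping `bβ = −1`, `a = u − bα`, and the relation read on the root `λ`
  obtain ⟨hbβ, hau⟩ := mul_eq_neg_one_and_eq_of_rel h10 hrel
  set Θt : K := algebraMap E K α + algebraMap E K β * lam with hΘtdef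
  have hrelK : algebraMap E K u - lam = algebraMap E K a + algebraMap E K b * Θt := by
    have hbβK : algebraMap E K b * algebraMap E K β = -1 := by rw [← map_mul, hbβ, map_neg, map_one]
    rw [hΘtdef, hau, map_sub, map_mul]
    linear_combination (-lam) * hbβK
  -- ### 2. Θ̃ is a root of `χ_Θ` (★ (ζ1c)), with integral trace ∕ determinant data
  have hΘtroot := eigenUniformiser_isRoot_of_isRoot g hlam α β
  have htrO : (α • (1 : Matrix (Fin 2) (Fin 2) E) + β • g).trace ∈ 𝒪[E] := (Valuation.mem_integer_iff _ _).2 hΘt.le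
  have hdetO : (α • (1 : Matrix (Fin 2) (Fin 2) E) + β • g).det ∈ 𝒪[E] := (Valuation.mem_integer_iff _ _).2 (hΘd ▸ hϖ.valuation_le_one)
  have hΘt' : Θt ^ 2 - algebraMap E K ((⟨_, htrO⟩ : 𝒪[E]) : E) * Θt + algebraMap E K ((⟨_, hdetO⟩ : 𝒪[E]) : E) = 0 := hΘtroot
  obtain ⟨hΘO, p₀, q₀, hΘcoord, hq₀, -⟩ := exists_coord_of_eigenUniformiser hval hϖ hΘt' hΘt hΘd jO hjO θ hθ ha hk₁ hcoord
  -- ### 3. integrality of `u`, `b`, `a`, `tr g`, `det g`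
  have hbO : b ∈ 𝒪[E] := (Valuation.mem_integer_iff _ _).2 (by rw [hb]; exact pow_le_one₀ zero_le hϖ.valuation_le_one)
  have htO : g.trace ∈ 𝒪[E] := trace_fin_two_mem_integer hg
  have hDO : g.det ∈ 𝒪[E] := det_fin_two_mem_integer hg
  have hlamO : lam ∈ 𝒪[K] :=
    mem_integer_of_eigenUniformiser hval (Θt := lam) (tΘ := ⟨_, htO⟩) (dΘ := ⟨_, hDO⟩) hlam
  have haO : a ∈ 𝒪[E] := by
    -- `bα = bΘ̃ + λ` is integral in `K`, hence in `E`
    have hbα : algebraMap E K (b * α) = algebraMap E K b * Θt + lam := by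
      have hbβK : algebraMap E K b * algebraMap E K β = -1 := by rw [← map_mul, hbβ, map_neg, map_one]
      rw [hΘtdef, map_mul]
      linear_combination (-lam) * hbβK
    have hbαK : algebraMap E K (b * α) ∈ 𝒪[K] := by
      rw [hbα]
      exact add_mem (mul_mem (by simpa [hjO] using (jO ⟨b, hbO⟩).2) hΘO) hlamO
    have hbαE : b * α ∈ 𝒪[E] := (Valuation.mem_integer_iff _ _).2 ((hval _).1 ((Valuation.mem_integer_iff _ _).1 hbαK))
    rw [hau]
    exact sub_mem hu hbαE
  -- ### 4. ★ (ζ1b): the Eisenstein coordinates of `λ`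
  have hrelO : algebraMap E K ((⟨u, hu⟩ : 𝒪[E]) : E) - lam = algebraMap E K ((⟨a, haO⟩ : 𝒪[E]) : E) + algebraMap E K ((⟨b, hbO⟩ : 𝒪[E]) : E) * Θt := hrelK
  obtain ⟨hlamO', hlamcoord, hvq⟩ := exists_coord_eigenvalue_of_rel jO hjO θ hΘO hΘcoord hq₀ hrelO
  set uO : 𝒪[E] := ⟨u, hu⟩ with huO
  set tO : 𝒪[E] := ⟨g.trace, htO⟩ with htOdef
  set DO : 𝒪[E] := ⟨g.det, hDO⟩ with hDOdef
  set pO : 𝒪[E] := ⟨u, hu⟩ - ⟨a, haO⟩ - ⟨b, hbO⟩ * p₀ with hpO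
  set qO : 𝒪[E] := -(⟨b, hbO⟩ * q₀) with hqO
  set L : 𝒪[K] := jO pO + jO qO * θ with hL
  have hLcoe : (L : K) = lam := by
    have h := congrArg Subtype.val hlamcoord
    exact h.symm
  refine ⟨uO, pO, qO, tO, DO, rfl, rfl, rfl, hLcoe, ?_, ?_, ?_, ?_⟩
  · -- `hlam2` in `𝒪[K]`
    apply Subtype.ext
    change ((L ^ 2 - jO tO * L + jO DO : 𝒪[K]) : K) = 0
    push_cast
    rw [hLcoe, hjO, hjO]
    exact hlam
  · -- `hstarmem`: `x⋆ = P(x) = P₀(x)` with `P₀ ∈ 𝒪_E[X]`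
    obtain ⟨P₀, hP₀⟩ := exists_map_integer_subtype_eq_of_coeff_mem hP
    have hcoe : RingHom.prodMap (𝒪[E]).subtype (𝒪[K]).subtype (Polynomial.eval₂RingHom (RingHom.prod (RingHom.id 𝒪[E]) jO) (uO, L) P₀) = (σ u, σK lam) := by
      rw [prodMap_subtype_eval₂_eq jO hjO uO L P₀, hP₀, hLcoe]
      exact hPx
    refine ⟨P₀, Prod.ext (Subtype.ext ?_) (Subtype.ext ?_)⟩
    · have h1 := congrArg Prod.fst hcoe
      rw [show ((RingHom.prodMap σO σKO ((uO, L) : 𝒪[E] × 𝒪[K])).1 : E) = σ u from hσO uO]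
      exact h1
    · have h2 := congrArg Prod.snd hcoe
      rw [show ((RingHom.prodMap σO σKO ((uO, L) : 𝒪[E] × 𝒪[K])).2 : K) = σK lam by rw [← hLcoe]; exact hσKO L]
      exact h2
  · -- `hN`
    rw [hqO, hvq]; exact hb
  · -- `hn`
    have hdet : (u • (1 : Matrix (Fin 2) (Fin 2) E) - g).det = u * u - g.trace * u + g.det :=
      Literature.NumberTheory.Rogawski1990.det_smul_one_sub_eq g u
    have : ((uO * uO - tO * uO + DO : 𝒪[E]) : E) = (u • (1 : Matrix (Fin 2) (Fin 2) E) - g).det := by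
      rw [hdet]; rfl
    rw [this, hn]

end Pair

/-! ## §3 Composition with ★ (c6): the glued type-(2) order of the Eisenstein data -/

section Order

variable {F E : Type*} [Field F] [ValuativeRel F] [Field E] [ValuativeRel E] {K : Type*} [Field K] [ValuativeRel K] [Algebra E K]
  (hval : ∀ x : E, valuation K (algebraMap E K x) ≤ 1 ↔ valuation E x ≤ 1)
  (ιO : 𝒪[F] →+* 𝒪[E]) (σO : 𝒪[E] →+* 𝒪[E]) (jO : 𝒪[E] →+* 𝒪[K]) (σKO : 𝒪[K] →+* 𝒪[K]) (θ : 𝒪[K]) {aF k₀F : 𝒪[F]}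
  (σ : E →+* E) (σK : K →+* K)
  (hjO : ∀ x : 𝒪[E], ((jO x : 𝒪[K]) : K) = algebraMap E K x)
  (hσO : ∀ x : 𝒪[E], ((σO x : 𝒪[E]) : E) = σ x) (hσKO : ∀ z : 𝒪[K], ((σKO z : 𝒪[K]) : K) = σK z)
  (hσσ : ∀ x, σO (σO x) = x) (hσι : ∀ y, σO (ιO y) = ιO y) (hfixO : ∀ x, σO x = x → ∃ y, ιO y = x)
  (hιu : ∀ y, IsUnit (ιO y) → IsUnit y) (hσ₁j : ∀ x, σKO (jO x) = jO (σO x)) (hσ₁θ : σKO θ = θ)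
  (hθ : θ ^ 2 = jO (ιO aF) * θ + jO (ιO k₀F)) (haF : aF ∈ IsLocalRing.maximalIdeal 𝒪[F])
  (hcoord : ∀ z : 𝒪[K], ∃! bc : 𝒪[E] × 𝒪[E], z = jO bc.1 + jO bc.2 * θ) (htr : ∃ b₀ : 𝒪[E], b₀ + σO b₀ = 1)
  {ϖF : F} {ϖ : E} (hϖF : IsUniformizingElement ϖF) (hϖ : IsUniformizingElement ϖ) (hιϖ : ιO ⟨ϖF, hϖF.mem⟩ = ⟨ϖ, hϖ.mem⟩)
  (hk₁ : valuation E ((ιO k₀F : 𝒪[E]) : E) = valuation E ϖ)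

include hval hjO hσO hσKO hσσ hσι hfixO hιu hσ₁j hσ₁θ hθ haF hcoord htr hιϖ hk₁ in
/-- **(D′2, COMPOSED) THE GLUED TYPE-(2) ORDER OF THE EISENSTEIN DATA, ⋆-POLYNOMIAL FORM.**  Over the inert dictionary + Eisenstein letters of ★ F3-3 ∕ ★ (c5-ii) A (`ιO σO jO σKO θ`, …), from ★ (W1)'s
`hT` data and a unitary root `λ` of `χ_g` as in `exists_integralPair_of_eisensteinData`: `𝒪_E[(uO, λ)] = G(N′, n′, ιO y)` for some `y ∈ 𝒪_F` at a MONOGENIC level — EITHER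
`n′ = 2N′+1 ∧ y ∈ (ϖ_F^{N′+1})` OR `n′ = 2M`, `M ≤ N′`, `y ∈ (ϖ_F^M) ∖ (ϖ_F^{M+1})` (`M = 0` = the product-order boundary row) — by ★ D′α `exists_coe_range_eval₂_eq_glued_map_of_star_mem` (no `hk₀` binder).
F3-5b-III's rows `xR ∕ hxR ∕ cF ∕ hR ∕ hlaw` in one `obtain`. [cite: Rogawski1990, §4.9 Lemma 4.9.3 p. 56, Prop. 4.9.1 (b) p. 55] [cite: Neukirch1999, Ch. I §12] [cite: SerreLocalFields1979, Ch. I §6 Prop. 17–18] -/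
theorem exists_typeTwoOrder_of_eisensteinData_of_starPoly
    {g Θ : Matrix (Fin 2) (Fin 2) E} {u α β a b : E} {n N : ℕ}
    (hg : ∀ i j, g i j ∈ 𝒪[E]) (hu : u ∈ 𝒪[E]) (h10 : g 1 0 ≠ 0)
    (hΘ : Θ = α • 1 + β • g) (hΘd : valuation E Θ.det = valuation E ϖ) (hΘt : valuation E Θ.trace < 1)
    (hrel : u • (1 : Matrix (Fin 2) (Fin 2) E) - g = a • 1 + b • Θ)
    (hn : valuation E (u • (1 : Matrix (Fin 2) (Fin 2) E) - g).det = valuation E ϖ ^ n) (hb : valuation E b = valuation E ϖ ^ N)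
    {lam : K} (hlam : lam ^ 2 - algebraMap E K g.trace * lam + algebraMap E K g.det = 0)
    (P : E[X]) (hP : ∀ i, P.coeff i ∈ 𝒪[E]) (hPx : aeval ((u, lam) : E × K) P = (σ u, σK lam)) :
    ∃ (uO pO qO tO DO : 𝒪[E]) (y : 𝒪[F]), (uO : E) = u ∧ (tO : E) = g.trace ∧ (DO : E) = g.det ∧ ((jO pO + jO qO * θ : 𝒪[K]) : K) = lam ∧
      (jO pO + jO qO * θ) ^ 2 - jO tO * (jO pO + jO qO * θ) + jO DO = 0 ∧
      RingHom.prodMap σO σKO ((uO, jO pO + jO qO * θ) : 𝒪[E] × 𝒪[K]) ∈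
        (Polynomial.eval₂RingHom (RingHom.prod (RingHom.id 𝒪[E]) jO) ((uO, jO pO + jO qO * θ) : 𝒪[E] × 𝒪[K])).range ∧
      valuation E ((qO : 𝒪[E]) : E) = valuation E ϖ ^ N ∧
      valuation E ((uO * uO - tO * uO + DO : 𝒪[E]) : E) = valuation E ϖ ^ n ∧
      ((Polynomial.eval₂RingHom (RingHom.prod (RingHom.id 𝒪[E]) jO) ((uO, jO pO + jO qO * θ) : 𝒪[E] × 𝒪[K])).range : Set (𝒪[E] × 𝒪[K])) =
        {z : 𝒪[E] × 𝒪[K] | ∃ b₀ c₀ : 𝒪[E], z.2 = jO b₀ + jO c₀ * (jO ((⟨ϖ, hϖ.mem⟩ : 𝒪[E]) ^ N) * θ) ∧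
          z.1 - (b₀ + c₀ * ιO y) ∈ Ideal.span {(⟨ϖ, hϖ.mem⟩ : 𝒪[E]) ^ n}} ∧
      ((n = 2 * N + 1 ∧ y ∈ Ideal.span {(⟨ϖF, hϖF.mem⟩ : 𝒪[F]) ^ (N + 1)}) ∨
        ∃ M : ℕ, M ≤ N ∧ n = 2 * M ∧ y ∈ Ideal.span {(⟨ϖF, hϖF.mem⟩ : 𝒪[F]) ^ M} ∧
          y ∉ Ideal.span {(⟨ϖF, hϖF.mem⟩ : 𝒪[F]) ^ (M + 1)}) := by
  have ha : ιO aF ∈ IsLocalRing.maximalIdeal 𝒪[E] := map_k₀_mem_maximalIdeal ιO hιu haF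
  obtain ⟨uO, pO, qO, tO, DO, huO, htO, hDO, hLcoe, hlam2, hstarmem, hN, hn'⟩ :=
    exists_integralPair_of_eisensteinData_of_starPoly hval jO hjO θ hθ ha hϖ hk₁ hcoord σ σK σO hσO σKO hσKO hg hu h10 hΘ hΘd hΘt hrel hn hb hlam P hP hPx
  obtain ⟨y, hR, hlvl⟩ :=
    exists_coe_range_eval₂_eq_glued_map_of_star_mem jO θ σO σKO ιO hσσ hσι hfixO hιu hσ₁j hσ₁θ hθ haF hcoord htr hϖF hϖ hιϖ hk₁ hlam2 hstarmem hN hn'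
  exact ⟨uO, pO, qO, tO, DO, y, huO, htO, hDO, hLcoe, hlam2, hstarmem, hN, hn', hR, hlvl⟩

end Order

end Literature.NumberTheory.Automorphic

end
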